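import Literature.MathematicalPhysics.QuantumFieldTheory.ConformalBootstrap3D.PointKernelK34Data

/-!
# K34 certificate, kernel block file H0: head segments `0 ≤ i < 6` of `hsegs`, one theorem per segment (cells checked corner or chord by the rule bit)

`decide` by kernel reduction (no `native_decide`, no extra axioms) of the block checker of
`PointKernel` on the literal data of `PointKernelK34Data`; soundness is `PCert.hBlockOK_sound`.
Estimated kernel time 245 s (6 theorems).
-/

set_option maxRecDepth 100000
set_option maxHeartbeats 0

namespace Literature.MathematicalPhysics.QuantumFieldTheory.ConformalBootstrap3D.PointKernelK34

open Literature.MathematicalPhysics.QuantumFieldTheory.ConformalBootstrap3D.PointKernel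

/-- head segment `[0, 1)` passes the kernel evaluator. [folklore] -/
theorem hBlock_0 : cert.hBlockOK hsegs 0 1 JH = true := by
  decide +kernel

/-- head segment `[1, 2)` passes the kernel evaluator. [folklore] -/
theorem hBlock_1 : cert.hBlockOK hsegs 1 2 JH = true := by
  decide +kernel

/-- head segment `[2, 3)` passes the kernel evaluator. [folklore] -/
theorem hBlock_2 : cert.hBlockOK hsegs 2 3 JH = true := by
  decide +kernel

/-- head segment `[3, 4)` passes the kernel evaluator. [folklore] -/
theorem hBlock_3 : cert.hBlockOK hsegs 3 4 JH = true := by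
  decide +kernel

/-- head segment `[4, 5)` passes the kernel evaluator. [folklore] -/
theorem hBlock_4 : cert.hBlockOK hsegs 4 5 JH = true := by
  decide +kernel

/-- head segment `[5, 6)` passes the kernel evaluator. [folklore] -/
theorem hBlock_5 : cert.hBlockOK hsegs 5 6 JH = true := by
  decide +kernel

end Literature.MathematicalPhysics.QuantumFieldTheory.ConformalBootstrap3D.PointKernelK34
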